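import Literature.MathematicalPhysics.QuantumFieldTheory.ConformalBootstrap3D.SL2BlockCoefficients
import Mathlib.Tactic
import HarnessLib

/-!
# Dimensional reduction `3 → 2` of conformal blocks (Hogervorst 2016): the engine, and a proof for scalar blocks

Hogervorst (JHEP 09 (2016) 017, eq. (2.24)) expands a `d`-dimensional conformal block of equal external
scalars in `(d-1)`-dimensional blocks, `G^{(d)}_{Δ,ℓ} = Σ_{n ≥ 0} Σ_{j} 𝒜_{n,j}(Δ,ℓ) G^{(d-1)}_{Δ+2n,j}`, and gives
the coefficients `𝒜` in CLOSED FORM (his eq. (2.35), "master formula"; eq. (2.24) is the expansion itself) with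
the remark "While we don't have a rigorous proof of this formula, we have checked that it satisfies [the recursion]
for `ℓ, n ≤ 20` and we conjecture that it holds in general." Pal–Qiao–Rychkov (Comm. Math. Phys. 402 (2023), App. A.2) restate it as
"Theorem A.5 (Hogervorst)", use it in the proof of their twist-accumulation theorem, and note "The complete proof
that [it] is a solution of Hogervorst's recursion relations is so far missing". For `d = 3` a derivation was then
given by Song, Phys. Rev. Lett. 135 (2025) 211603 [arXiv:2311.05375] (half-derivative conjugation of the Casimir
equation making the coefficient recursion separable at `ν = ½`; his `A^{(3d)}_{n,m}`, §1 and §3, is eq. (2.35) at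
`d = 3` up to the normalisation of `k` — see `DimensionalReductionSpin` for the dictionary and an exact check).
This file PROVES the formula at `d = 3` (the dimension of this directory) for SCALAR blocks, `ℓ = 0`, by an
independent elementary argument, and sets up the engine used for all spins in `DimensionalReductionSpin`:

* **Engine (§1).** Put `f_a(z) = k_{2(α+a)}(z)`, `α = (Δ-ℓ)/2`, the SL(2) blocks (`SL2BlockCoefficients`), and
  consider a formal sum `F = Σ_{a,b ≥ 0} c_{ab} f_a(z) f_b(z̄)` with a symmetric site function `c`. Its monomial
  array is `redArr c (P,Q) = Σ_{a ≤ P, b ≤ Q} c_{ab} K_a(P) K_b(Q)`. By `SL2BlockCoefficients` (the operators `z⁻¹`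
  and `(1-z)∂_z` act tridiagonally on `k_{2h}`), the three-dimensional Casimir form of
  `BlockCoefficientUniqueness` — `(z-z̄)(D_z+D_z̄-c₃) + z z̄[(1-z)∂_z-(1-z̄)∂_z̄]` — maps `f_a ⊗ f_b` to its four
  lattice NEIGHBOURS `f_{a±1} ⊗ f_b`, `f_a ⊗ f_{b±1}` (`coeffCasimirLHS_prodArr_eq_psi`, `sitePsi_succ`,
  `sitePsi_zero`); the self-couplings cancel. Hence (`redArr_satisfiesCoeffCasimir`) the array of `F` satisfies the
  coefficient Casimir system `SatisfiesCoeffCasimir 0 0 Δ ℓ` as soon as `c` obeys the four-term ODD-SITE RELATION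
  `U_{ab} = U_{ba}` (`siteU`), `U_{ab} = c_{a,b+1}(μ_{a,b+1}-h_{b+1}) + c_{ab} μ_{ab}/2 + W_{ab}`,
  `μ_{ab} = h_a(h_a-1)+h_b(h_b-1)-c₃`, `h_a = α + a` — a finite recurrence on the lattice.
* **Scalar blocks (§2).** For `ℓ = 0` the diagonal site function `c_{ab} = δ_{ab} 𝒜_{a,0}(Δ,0)` with Hogervorst's
  `𝒜_{n,0}(Δ,0) = (½)_n (Δ/2)_n³ / (4^n n! (Δ-½)_n (Δ-1+n)_n ((Δ+1)/2)_n)` (`scalarRedCoeff`, his display after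
  (2.35) at `ν = ½`) satisfies the odd-site relation — it reduces to the two-term recurrence
  `𝒜_{n+1,0}·4(n+1)(2Δ+2n-1)(Δ+2n-1)(Δ+2n+1) = 𝒜_{n,0}·(2n+1)(Δ/2+n)²(Δ+n-1)` (`scalarRedCoeff_succ`) — so by
  uniqueness of the block array (`SatisfiesCoeffCasimir.eq_hrMonomialCoeff`, `BlockCoefficientExistence`):
  **`hrMonomialCoeff_eq_scalar_redArr`**: for every `Δ > 1/2` the monomial array of the `d = 3` scalar block of
  dimension `Δ` is the array of `Σ_n 𝒜_{n,0}(Δ,0) k_{Δ+2n}(z) k_{Δ+2n}(z̄)`, i.e. Hogervorst's eqs. (2.24)/(2.35) at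
  `d = 3`, `ℓ = 0`, coefficient by coefficient (`hrMonomialCoeff_scalar_apply`).

What is NOT here: the function-level restatement `hrBlock Δ 0 z z̄ = Σ_n 𝒜_{n,0} k_{Δ+2n}(z) k_{Δ+2n}(z̄)` on
`(0,1)²` (a Tonelli regrouping of the absolutely convergent double series `hrSeries`; all terms are `≥ 0`);
spins `ℓ ≥ 1` (`DimensionalReductionSpin`); general `d` (the same argument works verbatim for `d → d-1` once
the tridiagonal action on `(d-1)`-dimensional blocks is available; only `d = 3` is typed in this directory);
positivity of the `ρ`-expansion (needs the quadratic transformation of `₂F₁(h,h;2h;·)`).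

References: M. Hogervorst, JHEP 09 (2016) 017 [arXiv:1604.08913], §2 eq. (2.24) (expansion), §2.1 eqs. (2.35)
(closed form) and (2.36) (scalar case) — arXiv and JHEP numbering agree; S. Pal, J. Qiao, S. Rychkov, Comm. Math.
Phys. 402 (2023) 2169, App. A.2 Thm A.5 (arXiv v5 numbering); C. Song, Phys. Rev. Lett. 135 (2025) 211603
[arXiv:2311.05375], §1, §3 (a derivation at `d = 3`); F. Dolan, H. Osborn, arXiv:1108.6194, §2 eqs. (2.10)–(2.12)
(the Casimir operator). The proof (nearest-neighbour action of the
Casimir difference on products of SL(2) blocks) is this file's; no step of it is taken from print.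
-/

namespace Literature.MathematicalPhysics.QuantumFieldTheory.ConformalBootstrap3D

open Finset

/-! ## 1. The lattice of products `k_{2h_a}(z) k_{2h_b}(z̄)` and the engine -/

section Engine

variable (Δ : ℝ) (ℓ : ℕ)

/-- `h_a = α + a`, `α = (Δ-ℓ)/2`: the weight of the `a`-th SL(2) block `f_a = k_{2h_a}` of the lattice.
[cite: Hogervorst2016, §2 eqs. (2.24), (2.35)] -/
noncomputable def siteWeight (a : ℕ) : ℝ := halfTwist Δ ℓ + a

/-- `μ_{ab} = h_a(h_a-1) + h_b(h_b-1) - c₃(Δ,ℓ)`: the eigenvalue of `D_z + D_z̄ - c₃` on the product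
`f_a(z) f_b(z̄)` (`D_z k_{2h} = h(h-1) k_{2h}`). [cite: DolanOsborn2011, §2 eqs. (2.10)–(2.12)] -/
noncomputable def siteMu (a b : ℕ) : ℝ :=
  siteWeight Δ ℓ a * (siteWeight Δ ℓ a - 1) + siteWeight Δ ℓ b * (siteWeight Δ ℓ b - 1)
    - casimirEigenvalue3D Δ ℓ

/-- `K_a(m)`: the coefficient of `z^{α+m}` in `f_a(z) = k_{2h_a}(z) = Σ_i κ_{h_a}(i) z^{h_a+i}`, i.e.
`κ_{h_a}(m-a)` (zero for `m < a`), integer `m`. [cite: DolanOsborn2011, §4 eq. (4.5)] -/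
noncomputable def siteK (a : ℕ) (m : ℤ) : ℝ := sl2CoeffZ (halfTwist Δ ℓ + a) (m - a)

/-- `Ψ_{μ,b}(m) = (μ - α - m - 1) K_b(m+1) + (α+m) K_b(m)`: the coefficient of `z^{α+m}` in
`ψ(z) = μ f_b(z)/z - (1-z) f_b'(z)`. [folklore] -/
noncomputable def sitePsi (μ : ℝ) (b : ℕ) (m : ℤ) : ℝ :=
  (μ - halfTwist Δ ℓ - m - 1) * siteK Δ ℓ b (m + 1) + (halfTwist Δ ℓ + m) * siteK Δ ℓ b m

/-- The array of `Σ_{a,b} c_{ab} f_a(z) f_b(z̄) = (z z̄)^α Σ_{P,Q} red_{PQ} z^P z̄^Q`: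
`red_{PQ} = Σ_{a ≤ P, b ≤ Q} c_{ab} K_a(P) K_b(Q)` (a finite sum for each `(P,Q)`). [folklore] -/
noncomputable def redArr (c : ℕ → ℕ → ℝ) (p : ℕ × ℕ) : ℝ :=
  ∑ a ∈ range (p.1 + 1), ∑ b ∈ range (p.2 + 1), c a b * siteK Δ ℓ a p.1 * siteK Δ ℓ b p.2

variable {Δ ℓ}

/-- `K_a(m) = 0` for `m < a`. [folklore] -/
theorem siteK_eq_zero_of_lt (a : ℕ) {m : ℤ} (hm : m < a) : siteK Δ ℓ a m = 0 :=
  sl2CoeffZ_of_neg _ (by omega)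

/-- `K_a(a) = 1`. [folklore] -/
@[simp] theorem siteK_self (a : ℕ) : siteK Δ ℓ a a = 1 := by
  simp [siteK]

/-- `K_a(m) ≥ 0` when `α > 0`. [folklore] -/
theorem siteK_nonneg (hα : 0 < halfTwist Δ ℓ) (a : ℕ) (m : ℤ) : 0 ≤ siteK Δ ℓ a m :=
  sl2CoeffZ_nonneg (by positivity) _

/-- The SL(2) eigen-equation for `f_a`, coefficientwise (integer `m`):
`((α+m+1)(α+m) - h_a(h_a-1)) K_a(m+1) = (α+m)² K_a(m)`. [cite: DolanOsborn2011, §2 eq. (2.11)] -/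
theorem siteK_rec (hα : 0 < halfTwist Δ ℓ) (a : ℕ) (m : ℤ) :
    ((halfTwist Δ ℓ + m + 1) * (halfTwist Δ ℓ + m) - siteWeight Δ ℓ a * (siteWeight Δ ℓ a - 1))
        * siteK Δ ℓ a (m + 1) = (halfTwist Δ ℓ + m) ^ 2 * siteK Δ ℓ a m := by
  have h := sl2CoeffZ_rec (show 0 < halfTwist Δ ℓ + a by positivity) (m - a)
  unfold siteK siteWeight
  rw [show m + 1 - (a : ℤ) = m - a + 1 by ring]
  have e : ((m - a : ℤ) : ℝ) = (m : ℝ) - a := by push_cast; ring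
  rw [e] at h
  linear_combination h

/-! ### The five weights with real arguments -/

/-- `A(x,y)` with real arguments (`a = b = 0`). [cite: DolanOsborn2011, §2 eqs. (2.10)–(2.12)] -/
noncomputable def wA (Δ : ℝ) (ℓ : ℕ) (x y : ℝ) : ℝ :=
  (x + halfTwist Δ ℓ) * (x + halfTwist Δ ℓ - 1) + (y + halfTwist Δ ℓ) * (y + halfTwist Δ ℓ - 1)
    - casimirEigenvalue3D Δ ℓ - (y + halfTwist Δ ℓ)

/-- `B(x,y)` with real arguments. [cite: DolanOsborn2011, §2 eqs. (2.10)–(2.12)] -/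
noncomputable def wB (Δ : ℝ) (ℓ : ℕ) (x y : ℝ) : ℝ :=
  -((x + halfTwist Δ ℓ) * (x + halfTwist Δ ℓ - 1) + (y + halfTwist Δ ℓ) * (y + halfTwist Δ ℓ - 1)
    - casimirEigenvalue3D Δ ℓ) + (x + halfTwist Δ ℓ)

/-- `C(x) = -(x+α)²` (`a = b = 0`). [cite: DolanOsborn2011, §2 eq. (2.11)] -/
noncomputable def wC (Δ : ℝ) (ℓ : ℕ) (x : ℝ) : ℝ := -((x + halfTwist Δ ℓ) * (x + halfTwist Δ ℓ))

/-- `D(x,y) = (x+α)² - (y+α)² - (x+α) + (y+α)` (`a = b = 0`). [cite: DolanOsborn2011, §2 eqs. (2.10)–(2.12)] -/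
noncomputable def wD (Δ : ℝ) (ℓ : ℕ) (x y : ℝ) : ℝ :=
  (x + halfTwist Δ ℓ) * (x + halfTwist Δ ℓ) - (y + halfTwist Δ ℓ) * (y + halfTwist Δ ℓ)
    - (x + halfTwist Δ ℓ) + (y + halfTwist Δ ℓ)

/-- `E(y) = (y+α)²` (`a = b = 0`). [cite: DolanOsborn2011, §2 eq. (2.11)] -/
noncomputable def wE (Δ : ℝ) (ℓ : ℕ) (y : ℝ) : ℝ := (y + halfTwist Δ ℓ) * (y + halfTwist Δ ℓ)

/-- `coeffA` is `wA` at natural arguments. [folklore] -/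
theorem coeffA_eq_wA (m n : ℕ) : coeffA Δ ℓ m n = wA Δ ℓ m n := by
  unfold coeffA wA; ring

/-- `coeffB` is `wB` at natural arguments. [folklore] -/
theorem coeffB_eq_wB (m n : ℕ) : coeffB Δ ℓ m n = wB Δ ℓ m n := by
  unfold coeffB wB; ring

/-- `coeffC 0 0` is `wC` at natural arguments. [folklore] -/
theorem coeffC_eq_wC (m : ℕ) : coeffC 0 0 Δ ℓ m = wC Δ ℓ m := by
  unfold coeffC wC; ring

/-- `coeffD 0 0` is `wD` at natural arguments. [folklore] -/
theorem coeffD_eq_wD (m n : ℕ) : coeffD 0 0 Δ ℓ m n = wD Δ ℓ m n := by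
  unfold coeffD wD; ring

/-- `coeffE 0 0` is `wE` at natural arguments. [folklore] -/
theorem coeffE_eq_wE (n : ℕ) : coeffE 0 0 Δ ℓ n = wE Δ ℓ n := by
  unfold coeffE wE; ring

/-- The product array `(K_a ⊗ K_b)(P,Q) = K_a(P) K_b(Q)`. [folklore] -/
noncomputable def prodArr (Δ : ℝ) (ℓ : ℕ) (a b : ℕ) (p : ℕ × ℕ) : ℝ :=
  siteK Δ ℓ a p.1 * siteK Δ ℓ b p.2

/-- **Guard-free form of the coefficient system on a product array**: the five `if`s of
`coeffCasimirLHS` disappear because `K_a(-1) = K_a(-2) = 0`. [folklore] -/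
theorem coeffCasimirLHS_prodArr (a b P Q : ℕ) :
    coeffCasimirLHS 0 0 Δ ℓ (prodArr Δ ℓ a b) P Q =
      wA Δ ℓ ((P : ℝ) - 1) Q * (siteK Δ ℓ a ((P : ℤ) - 1) * siteK Δ ℓ b Q)
      + wB Δ ℓ P ((Q : ℝ) - 1) * (siteK Δ ℓ a P * siteK Δ ℓ b ((Q : ℤ) - 1))
      + wC Δ ℓ ((P : ℝ) - 2) * (siteK Δ ℓ a ((P : ℤ) - 2) * siteK Δ ℓ b Q)
      + wD Δ ℓ ((P : ℝ) - 1) ((Q : ℝ) - 1) * (siteK Δ ℓ a ((P : ℤ) - 1) * siteK Δ ℓ b ((Q : ℤ) - 1))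
      + wE Δ ℓ ((Q : ℝ) - 2) * (siteK Δ ℓ a P * siteK Δ ℓ b ((Q : ℤ) - 2)) := by
  have kA : siteK Δ ℓ a (-1) = 0 := siteK_eq_zero_of_lt a (by omega)
  have kA2 : siteK Δ ℓ a (-2) = 0 := siteK_eq_zero_of_lt a (by omega)
  have kB : siteK Δ ℓ b (-1) = 0 := siteK_eq_zero_of_lt b (by omega)
  have kB2 : siteK Δ ℓ b (-2) = 0 := siteK_eq_zero_of_lt b (by omega)
  have eA : (if 1 ≤ P then coeffA Δ ℓ (P - 1) Q * prodArr Δ ℓ a b (P - 1, Q) else 0) =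
      wA Δ ℓ ((P : ℝ) - 1) Q * (siteK Δ ℓ a ((P : ℤ) - 1) * siteK Δ ℓ b Q) := by
    by_cases hP : 1 ≤ P
    · obtain ⟨P', rfl⟩ := Nat.exists_eq_add_of_le hP
      rw [if_pos hP, coeffA_eq_wA]
      simp only [prodArr, Nat.add_sub_cancel_left]
      push_cast
      ring_nf
    · rw [if_neg hP]
      have hP0 : P = 0 := by omega
      subst hP0
      simp [kA]
  have eB : (if 1 ≤ Q then coeffB Δ ℓ P (Q - 1) * prodArr Δ ℓ a b (P, Q - 1) else 0) =
      wB Δ ℓ P ((Q : ℝ) - 1) * (siteK Δ ℓ a P * siteK Δ ℓ b ((Q : ℤ) - 1)) := by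
    by_cases hQ : 1 ≤ Q
    · obtain ⟨Q', rfl⟩ := Nat.exists_eq_add_of_le hQ
      rw [if_pos hQ, coeffB_eq_wB]
      simp only [prodArr, Nat.add_sub_cancel_left]
      push_cast
      ring_nf
    · rw [if_neg hQ]
      have hQ0 : Q = 0 := by omega
      subst hQ0
      simp [kB]
  have eC : (if 2 ≤ P then coeffC 0 0 Δ ℓ (P - 2) * prodArr Δ ℓ a b (P - 2, Q) else 0) =
      wC Δ ℓ ((P : ℝ) - 2) * (siteK Δ ℓ a ((P : ℤ) - 2) * siteK Δ ℓ b Q) := by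
    by_cases hP : 2 ≤ P
    · obtain ⟨P', rfl⟩ := Nat.exists_eq_add_of_le hP
      rw [if_pos hP, coeffC_eq_wC]
      simp only [prodArr, Nat.add_sub_cancel_left]
      push_cast
      ring_nf
    · rw [if_neg hP]
      interval_cases P
      · simp [kA2]
      · simp [kA]
  have eD : (if 1 ≤ P ∧ 1 ≤ Q then coeffD 0 0 Δ ℓ (P - 1) (Q - 1) * prodArr Δ ℓ a b (P - 1, Q - 1)
      else 0) =
      wD Δ ℓ ((P : ℝ) - 1) ((Q : ℝ) - 1) * (siteK Δ ℓ a ((P : ℤ) - 1) * siteK Δ ℓ b ((Q : ℤ) - 1)) := by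
    by_cases hPQ : 1 ≤ P ∧ 1 ≤ Q
    · obtain ⟨P', rfl⟩ := Nat.exists_eq_add_of_le hPQ.1
      obtain ⟨Q', rfl⟩ := Nat.exists_eq_add_of_le hPQ.2
      rw [if_pos hPQ, coeffD_eq_wD]
      simp only [prodArr, Nat.add_sub_cancel_left]
      push_cast
      ring_nf
    · rw [if_neg hPQ]
      rcases not_and_or.mp hPQ with hP | hQ
      · have hP0 : P = 0 := by omega
        subst hP0
        simp [kA]
      · have hQ0 : Q = 0 := by omega
        subst hQ0
        simp [kB]
  have eE : (if 2 ≤ Q then coeffE 0 0 Δ ℓ (Q - 2) * prodArr Δ ℓ a b (P, Q - 2) else 0) =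
      wE Δ ℓ ((Q : ℝ) - 2) * (siteK Δ ℓ a P * siteK Δ ℓ b ((Q : ℤ) - 2)) := by
    by_cases hQ : 2 ≤ Q
    · obtain ⟨Q', rfl⟩ := Nat.exists_eq_add_of_le hQ
      rw [if_pos hQ, coeffE_eq_wE]
      simp only [prodArr, Nat.add_sub_cancel_left]
      push_cast
      ring_nf
    · rw [if_neg hQ]
      interval_cases Q
      · simp [kB2]
      · simp [kB]
  unfold coeffCasimirLHS
  rw [eA, eB, eC, eD, eE]

/-- **Product formula.** On the product `f_a(z) f_b(z̄)` the three-dimensional Casimir form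
`(z-z̄)(D_z + D_z̄ - c₃) + z z̄[(1-z)∂_z - (1-z̄)∂_z̄]` acts as `(z f_a) ⊗ (z̄ ψ_b) - (z ψ_a) ⊗ (z̄ f_b)` with
`ψ = μ_{ab} f/z - (1-z) f'`; coefficientwise (guard-free, integer shifts):
`LHS(K_a ⊗ K_b)(P,Q) = K_a(P-1) Ψ_{μ,b}(Q-1) - Ψ_{μ,a}(P-1) K_b(Q-1)`, `μ = μ_{ab}`.
[cite: DolanOsborn2011, §2 eqs. (2.10)–(2.12)] -/
theorem coeffCasimirLHS_prodArr_eq_psi (hα : 0 < halfTwist Δ ℓ) (a b P Q : ℕ) :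
    coeffCasimirLHS 0 0 Δ ℓ (prodArr Δ ℓ a b) P Q =
      siteK Δ ℓ a ((P : ℤ) - 1) * sitePsi Δ ℓ (siteMu Δ ℓ a b) b ((Q : ℤ) - 1)
      - sitePsi Δ ℓ (siteMu Δ ℓ a b) a ((P : ℤ) - 1) * siteK Δ ℓ b ((Q : ℤ) - 1) := by
  rw [coeffCasimirLHS_prodArr]
  have rA2 := siteK_rec hα a ((P : ℤ) - 2)
  have rA1 := siteK_rec hα a ((P : ℤ) - 1)
  have rB2 := siteK_rec hα b ((Q : ℤ) - 2)
  have rB1 := siteK_rec hα b ((Q : ℤ) - 1)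
  rw [show (P : ℤ) - 2 + 1 = (P : ℤ) - 1 by ring] at rA2
  rw [show (P : ℤ) - 1 + 1 = (P : ℤ) by ring] at rA1
  rw [show (Q : ℤ) - 2 + 1 = (Q : ℤ) - 1 by ring] at rB2
  rw [show (Q : ℤ) - 1 + 1 = (Q : ℤ) by ring] at rB1
  unfold sitePsi siteMu wA wB wC wD wE
  rw [show (Q : ℤ) - 1 + 1 = (Q : ℤ) by ring, show (P : ℤ) - 1 + 1 = (P : ℤ) by ring]
  push_cast at rA2 rA1 rB2 rB1 ⊢
  linear_combination (siteK Δ ℓ b Q) * rA2 - (siteK Δ ℓ a P) * rB2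
    + (siteK Δ ℓ a ((P : ℤ) - 1)) * rB1 - (siteK Δ ℓ b ((Q : ℤ) - 1)) * rA1


/-! ### The `Ψ`-expansions in lattice indexing -/

/-- **T in lattice form** (`b+1 ≥ 1`, `α > 0`):
`Ψ_{μ,b+1}(m) = (μ - h_{b+1}) K_b(m) + (μ/2) K_{b+1}(m) + (μ + h_{b+1} - 1) γ_{h_{b+1}} K_{b+2}(m)`. [folklore] -/
theorem sitePsi_succ (hα : 0 < halfTwist Δ ℓ) (μ : ℝ) (b : ℕ) (m : ℤ) :
    sitePsi Δ ℓ μ (b + 1) m =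
      (μ - siteWeight Δ ℓ (b + 1)) * siteK Δ ℓ b m + μ / 2 * siteK Δ ℓ (b + 1) m
        + (μ + siteWeight Δ ℓ (b + 1) - 1) * sl2Gamma (siteWeight Δ ℓ (b + 1)) * siteK Δ ℓ (b + 2) m := by
  have hT := sl2CoeffZ_T (h := halfTwist Δ ℓ + b + 1) (by linarith) μ (m - b)
  rw [show halfTwist Δ ℓ + b + 1 - 1 = halfTwist Δ ℓ + b by ring,
    show halfTwist Δ ℓ + (b : ℝ) + 1 + 1 = halfTwist Δ ℓ + b + 2 by ring] at hT
  have k1 : siteK Δ ℓ (b + 1) (m + 1) = sl2CoeffZ (halfTwist Δ ℓ + b + 1) (m - b) := by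
    unfold siteK; congr 1 <;> push_cast <;> ring
  have k2 : siteK Δ ℓ (b + 1) m = sl2CoeffZ (halfTwist Δ ℓ + b + 1) (m - b - 1) := by
    unfold siteK; congr 1 <;> push_cast <;> ring
  have k3 : siteK Δ ℓ b m = sl2CoeffZ (halfTwist Δ ℓ + b) (m - b) := by
    unfold siteK; congr 1
  have k4 : siteK Δ ℓ (b + 2) m = sl2CoeffZ (halfTwist Δ ℓ + b + 2) (m - b - 2) := by
    unfold siteK; congr 1 <;> push_cast <;> ring
  have kw : siteWeight Δ ℓ (b + 1) = halfTwist Δ ℓ + b + 1 := by unfold siteWeight; push_cast; ring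
  unfold sitePsi
  rw [k1, k2, k3, k4, kw]
  push_cast at hT ⊢
  linear_combination hT

/-- `μ_{ℓ0} = h_0 = α`: at the corner site the `k_{2h-2}` ghost decouples. [folklore] -/
theorem siteMu_ell_zero : siteMu Δ ℓ ℓ 0 = halfTwist Δ ℓ := by
  unfold siteMu siteWeight halfTwist casimirEigenvalue3D
  push_cast
  ring

/-- `μ` is symmetric. [folklore] -/
theorem siteMu_comm (a b : ℕ) : siteMu Δ ℓ a b = siteMu Δ ℓ b a := by
  unfold siteMu; ring

/-- **T0 in lattice form** (`b = 0`, `μ = α = h_0`, `α > 0`):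
`Ψ_{α,0}(m) = (α/2) K_0(m) + γ'_{α} K_1(m)`. [folklore] -/
theorem sitePsi_zero (hα : 0 < halfTwist Δ ℓ) (m : ℤ) :
    sitePsi Δ ℓ (halfTwist Δ ℓ) 0 m =
      halfTwist Δ ℓ / 2 * siteK Δ ℓ 0 m + sl2Gamma' (halfTwist Δ ℓ) * siteK Δ ℓ 1 m := by
  have hT := sl2CoeffZ_comb hα (m + 1)
  rw [show m + 1 - 1 = m by ring, show m + 1 - 2 = m - 1 by ring] at hT
  have k1 : siteK Δ ℓ 0 (m + 1) = sl2CoeffZ (halfTwist Δ ℓ) (m + 1) := by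
    unfold siteK; congr 1 <;> push_cast <;> ring
  have k2 : siteK Δ ℓ 0 m = sl2CoeffZ (halfTwist Δ ℓ) m := by
    unfold siteK; congr 1 <;> push_cast <;> ring
  have k3 : siteK Δ ℓ 1 m = sl2CoeffZ (halfTwist Δ ℓ + 1) (m - 1) := by
    unfold siteK; congr 1; push_cast; ring
  unfold sitePsi
  rw [k1, k2, k3]
  push_cast at hT ⊢
  linear_combination -hT

/-! ### The four-term combination `U` and the reindexing identity -/

/-- The "incoming from below" part of `U`: `W_{a,0} = 0`, `W_{a,1} = c_{a0} γ'_{h_0}`,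
`W_{a,b+2} = c_{a,b+1} (μ_{a,b+1} + h_{b+1} - 1) γ_{h_{b+1}}`. [folklore] -/
noncomputable def siteW (Δ : ℝ) (ℓ : ℕ) (c : ℕ → ℕ → ℝ) (a : ℕ) : ℕ → ℝ
  | 0 => 0
  | 1 => c a 0 * sl2Gamma' (halfTwist Δ ℓ)
  | (b + 2) => c a (b + 1) * (siteMu Δ ℓ a (b + 1) + siteWeight Δ ℓ (b + 1) - 1)
      * sl2Gamma (siteWeight Δ ℓ (b + 1))

/-- `W_{a,b+2}` unfolds. [folklore] -/
theorem siteW_add_two (c : ℕ → ℕ → ℝ) (a b : ℕ) :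
    siteW Δ ℓ c a (b + 2) = c a (b + 1) * (siteMu Δ ℓ a (b + 1) + siteWeight Δ ℓ (b + 1) - 1)
      * sl2Gamma (siteWeight Δ ℓ (b + 1)) := rfl

/-- `W_{a,1}` unfolds. [folklore] -/
theorem siteW_one (c : ℕ → ℕ → ℝ) (a : ℕ) : siteW Δ ℓ c a 1 = c a 0 * sl2Gamma' (halfTwist Δ ℓ) := rfl

/-- `W_{a,0} = 0`. [folklore] -/
@[simp] theorem siteW_zero (c : ℕ → ℕ → ℝ) (a : ℕ) : siteW Δ ℓ c a 0 = 0 := rfl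

/-- **The four-term combination.** `U_{ab} = c_{a,b+1}(μ_{a,b+1} - h_{b+1}) + c_{ab} μ_{ab}/2 + W_{ab}`:
the coefficient of `f_a(z) f_b(z̄)` collected from the `z̄`-side action of the Casimir form on
`Σ c_{ab'} f_a f_{b'}`. The Casimir equation for the sum is `U_{ab} = U_{ba}` (`redArr_satisfiesCoeffCasimir`).
[folklore] -/
noncomputable def siteU (Δ : ℝ) (ℓ : ℕ) (c : ℕ → ℕ → ℝ) (a b : ℕ) : ℝ :=
  c a (b + 1) * (siteMu Δ ℓ a (b + 1) - siteWeight Δ ℓ (b + 1)) + c a b * siteMu Δ ℓ a b / 2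
    + siteW Δ ℓ c a b

/-- **Reindexing identity** (exact, with boundary terms): for every `a`, integer `m` and `N`,
`Σ_{b ≤ N} c_{ab} Ψ_{μ_{ab},b}(m) = Σ_{b ≤ N} U_{ab} K_b(m) - c_{a,N+1}(μ_{a,N+1} - h_{N+1}) K_N(m) + W_{a,N+1} K_{N+1}(m)`,
provided `c_{a0} = 0` unless `a = ℓ` (so that the `b = 0` slot carries `μ = h_0`). [folklore] -/
theorem sum_sitePsi_eq (hα : 0 < halfTwist Δ ℓ) (c : ℕ → ℕ → ℝ) (hc0 : ∀ a, a ≠ ℓ → c a 0 = 0)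
    (a : ℕ) (m : ℤ) (N : ℕ) :
    ∑ b ∈ range (N + 1), c a b * sitePsi Δ ℓ (siteMu Δ ℓ a b) b m =
      ∑ b ∈ range (N + 1), siteU Δ ℓ c a b * siteK Δ ℓ b m
        - c a (N + 1) * (siteMu Δ ℓ a (N + 1) - siteWeight Δ ℓ (N + 1)) * siteK Δ ℓ N m
        + siteW Δ ℓ c a (N + 1) * siteK Δ ℓ (N + 1) m := by
  induction N with
  | zero =>
    simp only [zero_add, range_one, sum_singleton, siteU, siteW_zero, siteW_one]
    -- the `b = 0` slot: either `a = ℓ` (then `μ_{a0} = α`) or `c_{a0} = 0`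
    by_cases ha : a = ℓ
    · subst ha
      rw [siteMu_ell_zero, sitePsi_zero hα]
      ring
    · rw [hc0 a ha]
      ring
  | succ N ih =>
    rw [Finset.sum_range_succ (fun b => c a b * sitePsi Δ ℓ (siteMu Δ ℓ a b) b m) (N + 1), ih,
      Finset.sum_range_succ (fun b => siteU Δ ℓ c a b * siteK Δ ℓ b m) (N + 1), sitePsi_succ hα,
      show N + 1 + 1 = N + 2 from rfl, siteW_add_two]
    simp only [siteU]
    ring

/-! ### Assembly: the Casimir system for `redArr c` -/

/-- Range extension: `Σ_{a ≤ M} c a * K_a(M') …` may be summed over any larger range since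
`K_a(M) = 0` for `a > M`. [folklore] -/
theorem sum_range_siteK_extend (f : ℕ → ℝ) (M : ℕ) {N : ℕ} (hN : M + 1 ≤ N) (m : ℤ) (hm : m ≤ M) :
    ∑ a ∈ range (M + 1), f a * siteK Δ ℓ a m = ∑ a ∈ range N, f a * siteK Δ ℓ a m := by
  apply Finset.sum_subset (range_subset_range.mpr hN)
  intro a haN haM
  rw [mem_range, not_lt] at haM
  rw [siteK_eq_zero_of_lt a (by omega), mul_zero]

/-- The fixed-range array `Σ_{a<N} Σ_{b<N} c_{ab} (K_a ⊗ K_b)`. [folklore] -/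
noncomputable def redArrN (Δ : ℝ) (ℓ : ℕ) (c : ℕ → ℕ → ℝ) (N : ℕ) (p : ℕ × ℕ) : ℝ :=
  ∑ a ∈ range N, ∑ b ∈ range N, c a b * prodArr Δ ℓ a b p

/-- `redArr` agrees with the fixed-range array on `[0,N-1]²`. [folklore] -/
theorem redArr_eq_redArrN (c : ℕ → ℕ → ℝ) {N : ℕ} (p : ℕ × ℕ) (h1 : p.1 + 1 ≤ N) (h2 : p.2 + 1 ≤ N) :
    redArr Δ ℓ c p = redArrN Δ ℓ c N p := by
  unfold redArr redArrN prodArr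
  have inner : ∀ a : ℕ, ∑ b ∈ range (p.2 + 1), c a b * siteK Δ ℓ a p.1 * siteK Δ ℓ b p.2 =
      ∑ b ∈ range N, c a b * (siteK Δ ℓ a p.1 * siteK Δ ℓ b p.2) := by
    intro a
    have := sum_range_siteK_extend (Δ := Δ) (ℓ := ℓ) (fun b => c a b * siteK Δ ℓ a p.1) p.2 h2 p.2 le_rfl
    simpa [mul_assoc] using this
  simp_rw [inner]
  -- now extend the outer range, pulling `K_a(p.1)` out as the last factor
  have outer := sum_range_siteK_extend (Δ := Δ) (ℓ := ℓ)
    (fun a => ∑ b ∈ range N, c a b * siteK Δ ℓ b p.2) p.1 h1 p.1 le_rfl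
  have e : ∀ a : ℕ, ∑ b ∈ range N, c a b * (siteK Δ ℓ a p.1 * siteK Δ ℓ b p.2) =
      (∑ b ∈ range N, c a b * siteK Δ ℓ b p.2) * siteK Δ ℓ a p.1 := by
    intro a; rw [Finset.sum_mul]; exact Finset.sum_congr rfl fun b _ => by ring
  simp_rw [e]
  exact outer

/-- Linearity of `coeffCasimirLHS` over the double sum defining `redArrN`. [folklore] -/
theorem coeffCasimirLHS_redArrN (c : ℕ → ℕ → ℝ) (N P Q : ℕ) :
    coeffCasimirLHS 0 0 Δ ℓ (redArrN Δ ℓ c N) P Q =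
      ∑ a ∈ range N, ∑ b ∈ range N, c a b * coeffCasimirLHS 0 0 Δ ℓ (prodArr Δ ℓ a b) P Q := by
  have hfun : redArrN Δ ℓ c N = fun p => ∑ a ∈ range N, (1 : ℝ) * (∑ b ∈ range N, c a b * prodArr Δ ℓ a b p) := by
    funext p; simp [redArrN]
  rw [hfun, coeffCasimirLHS_eq_add, coeffLAB_sum, coeffLCDE_sum, ← Finset.sum_add_distrib]
  refine Finset.sum_congr rfl fun a _ => ?_
  rw [one_mul, one_mul, coeffLAB_sum, coeffLCDE_sum, ← Finset.sum_add_distrib]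
  refine Finset.sum_congr rfl fun b _ => ?_
  rw [coeffCasimirLHS_eq_add]; ring

/-- **The engine.** If `c` is symmetric, vanishes on the row `b = 0` except at the corner `a = ℓ`, and
satisfies the odd-site relation `U_{ab} = U_{ba}` for all `a, b`, then the array of
`Σ_{a,b} c_{ab} k_{2h_a}(z) k_{2h_b}(z̄)` satisfies the three-dimensional coefficient Casimir system
(`a = b = 0` external parameters, spin `ℓ`). [folklore] -/
theorem redArr_satisfiesCoeffCasimir (hα : 0 < halfTwist Δ ℓ) (c : ℕ → ℕ → ℝ)
    (hsymm : ∀ a b, c a b = c b a) (hc0 : ∀ a, a ≠ ℓ → c a 0 = 0)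
    (hU : ∀ a b, siteU Δ ℓ c a b = siteU Δ ℓ c b a) :
    SatisfiesCoeffCasimir 0 0 Δ ℓ (redArr Δ ℓ c) := by
  intro P Q
  set N := P + Q + 2 with hN
  -- 1. replace `redArr` by the fixed-range array on the five points seen at `(P,Q)`
  have hloc : coeffCasimirLHS 0 0 Δ ℓ (redArr Δ ℓ c) P Q = coeffCasimirLHS 0 0 Δ ℓ (redArrN Δ ℓ c N) P Q := by
    rw [coeffCasimirLHS_eq_add, coeffCasimirLHS_eq_add]
    congr 1
    · exact coeffLAB_congr Δ ℓ (fun _ => redArr_eq_redArrN c _ (by simp; omega) (by simp; omega))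
        (fun _ => redArr_eq_redArrN c _ (by simp; omega) (by simp; omega))
    · exact coeffLCDE_congr 0 0 Δ ℓ (fun _ => redArr_eq_redArrN c _ (by simp; omega) (by simp; omega))
        (fun _ _ => redArr_eq_redArrN c _ (by simp; omega) (by simp; omega))
        (fun _ => redArr_eq_redArrN c _ (by simp; omega) (by simp; omega))
  rw [hloc, coeffCasimirLHS_redArrN]
  simp_rw [coeffCasimirLHS_prodArr_eq_psi hα, mul_sub, Finset.sum_sub_distrib]
  -- 2. the two halves
  obtain ⟨N', hN'⟩ : ∃ N', N = N' + 1 := ⟨P + Q + 1, by omega⟩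
  have hS1 : ∑ a ∈ range N, ∑ b ∈ range N,
      c a b * (siteK Δ ℓ a ((P : ℤ) - 1) * sitePsi Δ ℓ (siteMu Δ ℓ a b) b ((Q : ℤ) - 1)) =
      ∑ a ∈ range N, ∑ b ∈ range N,
        siteK Δ ℓ a ((P : ℤ) - 1) * siteK Δ ℓ b ((Q : ℤ) - 1) * siteU Δ ℓ c a b := by
    refine Finset.sum_congr rfl fun a _ => ?_
    have h := sum_sitePsi_eq hα c hc0 a ((Q : ℤ) - 1) N'
    rw [siteK_eq_zero_of_lt N' (by omega), siteK_eq_zero_of_lt (N' + 1) (by omega), mul_zero, mul_zero,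
      sub_zero, add_zero, ← hN'] at h
    calc ∑ b ∈ range N, c a b * (siteK Δ ℓ a ((P : ℤ) - 1) * sitePsi Δ ℓ (siteMu Δ ℓ a b) b ((Q : ℤ) - 1))
        = siteK Δ ℓ a ((P : ℤ) - 1) * ∑ b ∈ range N, c a b * sitePsi Δ ℓ (siteMu Δ ℓ a b) b ((Q : ℤ) - 1) := by
          rw [Finset.mul_sum]; exact Finset.sum_congr rfl fun b _ => by ring
      _ = siteK Δ ℓ a ((P : ℤ) - 1) * ∑ b ∈ range N, siteU Δ ℓ c a b * siteK Δ ℓ b ((Q : ℤ) - 1) := by rw [h]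
      _ = _ := by rw [Finset.mul_sum]; exact Finset.sum_congr rfl fun b _ => by ring
  have hS2 : ∑ a ∈ range N, ∑ b ∈ range N,
      c a b * (sitePsi Δ ℓ (siteMu Δ ℓ a b) a ((P : ℤ) - 1) * siteK Δ ℓ b ((Q : ℤ) - 1)) =
      ∑ b ∈ range N, ∑ a ∈ range N,
        siteK Δ ℓ a ((P : ℤ) - 1) * siteK Δ ℓ b ((Q : ℤ) - 1) * siteU Δ ℓ c b a := by
    rw [Finset.sum_comm]
    refine Finset.sum_congr rfl fun b _ => ?_
    have h := sum_sitePsi_eq hα c hc0 b ((P : ℤ) - 1) N'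
    rw [siteK_eq_zero_of_lt N' (by omega), siteK_eq_zero_of_lt (N' + 1) (by omega), mul_zero, mul_zero,
      sub_zero, add_zero, ← hN'] at h
    calc ∑ a ∈ range N, c a b * (sitePsi Δ ℓ (siteMu Δ ℓ a b) a ((P : ℤ) - 1) * siteK Δ ℓ b ((Q : ℤ) - 1))
        = siteK Δ ℓ b ((Q : ℤ) - 1) * ∑ a ∈ range N, c b a * sitePsi Δ ℓ (siteMu Δ ℓ b a) a ((P : ℤ) - 1) := by
          rw [Finset.mul_sum]
          exact Finset.sum_congr rfl fun a _ => by rw [hsymm a b, siteMu_comm a b]; ring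
      _ = siteK Δ ℓ b ((Q : ℤ) - 1) * ∑ a ∈ range N, siteU Δ ℓ c b a * siteK Δ ℓ a ((P : ℤ) - 1) := by rw [h]
      _ = _ := by rw [Finset.mul_sum]; exact Finset.sum_congr rfl fun a _ => by ring
  rw [hS1, hS2, sub_eq_zero, Finset.sum_comm]
  refine Finset.sum_congr rfl fun b _ => Finset.sum_congr rfl fun a _ => ?_
  rw [hU a b]

/-- `redArr c` is symmetric when `c` is. [folklore] -/
theorem redArr_symm (c : ℕ → ℕ → ℝ) (hsymm : ∀ a b, c a b = c b a) (p : ℕ × ℕ) :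
    redArr Δ ℓ c (p.2, p.1) = redArr Δ ℓ c p := by
  unfold redArr
  rw [Finset.sum_comm]
  exact Finset.sum_congr rfl fun a _ => Finset.sum_congr rfl fun b _ => by rw [hsymm b a]; ring

/-- `redArr c` has the Dolan–Osborn leading part when `c_{a0} = 0` for `a ≠ ℓ` and `c_{ℓ0} = 1`. [folklore] -/
theorem redArr_hasLeadingPart (c : ℕ → ℕ → ℝ) (hc0 : ∀ a, a ≠ ℓ → c a 0 = 0) (hc1 : c ℓ 0 = 1) :
    HasLeadingPart ℓ (redArr Δ ℓ c) := by
  have row : ∀ m : ℕ, redArr Δ ℓ c (m, 0) = ∑ a ∈ range (m + 1), c a 0 * siteK Δ ℓ a m := by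
    intro m
    unfold redArr
    refine Finset.sum_congr rfl fun a _ => ?_
    rw [zero_add, Finset.sum_range_one]
    have k00 : siteK Δ ℓ 0 ((0 : ℕ) : ℤ) = 1 := siteK_self 0
    simp only [k00, mul_one]
  refine ⟨fun m hm => ?_, ?_⟩
  · rw [row]
    refine Finset.sum_eq_zero fun a ha => ?_
    rw [mem_range] at ha
    rw [hc0 a (by omega), zero_mul]
  · rw [row, Finset.sum_range_succ, Finset.sum_eq_zero fun a ha => ?_, zero_add, hc1, one_mul, siteK_self]
    rw [mem_range] at ha
    rw [hc0 a (by omega), zero_mul]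

end Engine

/-! ## 2. The scalar case `ℓ = 0`: Hogervorst's `𝒜_{n,0}(Δ,0)` and the diagonal lattice -/

section Scalar

/-- **Hogervorst's scalar reduction coefficient at `d = 3`** (`ν = 1/2`, normalisations
`c_0^{(3)} = c_0^{(2)} = 1`): `𝒜_{n,0}(Δ,0) = (½)_n (Δ/2)_n³ / (4^n n! (Δ-½)_n (Δ-1+n)_n ((Δ+1)/2)_n)`,
the display after eq. (2.35)/"master" of Hogervorst 2016 specialised to `d = 3`.
[cite: Hogervorst2016, §2.1 eq. (2.36)] -/
noncomputable def scalarRedCoeff (Δ : ℝ) (n : ℕ) : ℝ :=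
  poch (1 / 2) n * poch (Δ / 2) n ^ 3 /
    (4 ^ n * (n.factorial : ℝ) * poch (Δ - 1 / 2) n * poch (Δ - 1 + n) n * poch ((Δ + 1) / 2) n)

/-- The scalar lattice: `c_{ab} = δ_{ab} 𝒜_{a,0}(Δ,0)` — only the diagonal products
`k_{Δ+2n}(z) k_{Δ+2n}(z̄) = G^{(2)}_{Δ+2n,0}` occur. [cite: Hogervorst2016, §2 eqs. (2.24), (2.35)] -/
noncomputable def scalarSite (Δ : ℝ) (a b : ℕ) : ℝ :=
  if a = b then scalarRedCoeff Δ a else 0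

/-- `𝒜_{0,0} = 1`. [folklore] -/
@[simp] theorem scalarRedCoeff_zero (Δ : ℝ) : scalarRedCoeff Δ 0 = 1 := by
  simp [scalarRedCoeff]

/-- `𝒜_{n,0}(Δ,0) > 0` for `Δ > 1/2` (the `d = 3` scalar unitarity bound). [cite: Hogervorst2016, §2.2] -/
theorem scalarRedCoeff_pos {Δ : ℝ} (hΔ : 1 / 2 < Δ) (n : ℕ) : 0 < scalarRedCoeff Δ n := by
  unfold scalarRedCoeff
  have h1 := poch_pos (by norm_num : (0 : ℝ) < 1 / 2) n
  have h2 := poch_pos (by linarith : (0 : ℝ) < Δ / 2) n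
  have h3 := poch_pos (by linarith : (0 : ℝ) < Δ - 1 / 2) n
  have h5 := poch_pos (by linarith : (0 : ℝ) < (Δ + 1) / 2) n
  have h4 : 0 < poch (Δ - 1 + n) n := by
    rcases Nat.eq_zero_or_pos n with rfl | hn
    · simp
    · have hn1 : (1 : ℝ) ≤ n := by exact_mod_cast hn
      exact poch_pos (by linarith) n
  positivity

/-- `𝒜_{1,0}(Δ,0) = Δ² / (16 (2Δ-1)(Δ+1))`. [folklore] -/
theorem scalarRedCoeff_one {Δ : ℝ} (hΔ : 1 / 2 < Δ) :
    scalarRedCoeff Δ 1 = Δ ^ 2 / (16 * (2 * Δ - 1) * (Δ + 1)) := by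
  unfold scalarRedCoeff
  simp only [poch_one, pow_one, Nat.factorial_one, Nat.cast_one, mul_one, sub_add_cancel]
  generalize et2 : (Δ + 1) / 2 = t2
  generalize et1 : Δ - 1 / 2 = t1
  generalize et3 : 2 * Δ - 1 = t3
  generalize et4 : Δ + 1 = t4
  have f1 : t1 ≠ 0 := by rw [← et1]; intro h; linarith
  have f2 : t2 ≠ 0 := by rw [← et2]; intro h; linarith
  have f3 : t3 ≠ 0 := by rw [← et3]; intro h; linarith
  have f4 : t4 ≠ 0 := by rw [← et4]; intro h; linarith
  have f0 : Δ ≠ 0 := by intro h; linarith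
  field_simp
  subst et1 et2 et3 et4
  ring

/-- **The ratio recursion** of the scalar coefficients (all `n`; at `n = 0` both sides carry the factor
`Δ - 1`, so the value of `𝒜_{1,0}` is recorded separately in `scalarRedCoeff_one`):
`𝒜_{n+1,0} · 4(n+1)(2Δ+2n-1)(Δ+2n-1)(Δ+2n+1) = 𝒜_{n,0} · (2n+1)(Δ/2+n)²(Δ+n-1)`. [folklore] -/
theorem scalarRedCoeff_succ {Δ : ℝ} (hΔ : 1 / 2 < Δ) {n : ℕ} (hn : 1 ≤ n) :
    scalarRedCoeff Δ (n + 1) * (4 * ((n : ℝ) + 1) * (2 * Δ + 2 * n - 1) * (Δ + 2 * n - 1) * (Δ + 2 * n + 1)) =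
      scalarRedCoeff Δ n * ((2 * (n : ℝ) + 1) * (Δ / 2 + n) ^ 2 * (Δ + n - 1)) := by
  unfold scalarRedCoeff
  have hn1 : (1 : ℝ) ≤ n := by exact_mod_cast hn
  -- the `(Δ-1+n)_n`-type factors: `X = (Δ+n)_{n+1}`, `Y = (Δ-1+n)_n`, `X (Δ-1+n) = Y (Δ+2n-1)(Δ+2n)`
  have eX : poch (Δ - 1 + ((n + 1 : ℕ) : ℝ)) (n + 1) =
      poch (Δ - 1 + n) n * (Δ + 2 * n - 1) * (Δ + 2 * n) / (Δ - 1 + n) := by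
    have hne : Δ - 1 + n ≠ 0 := by intro h; linarith
    have e1 : Δ - 1 + ((n + 1 : ℕ) : ℝ) = (Δ - 1 + n) + 1 := by push_cast; ring
    rw [eq_div_iff hne, e1, poch_succ]
    have AB : (Δ - 1 + n) * poch (Δ - 1 + n + 1) n = poch (Δ - 1 + n) n * (Δ - 1 + n + n) := by
      rw [← poch_succ_left, poch_succ]
    linear_combination (Δ - 1 + (n : ℝ) + 1 + n) * AB
  rw [eX, poch_succ, poch_succ, poch_succ, poch_succ, Nat.factorial_succ, pow_succ]
  push_cast
  -- atomise
  generalize eP1 : poch (1 / 2) n = P1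
  generalize eP2 : poch (Δ / 2) n = P2
  generalize eP3 : poch (Δ - 1 / 2) n = P3
  generalize eP4 : poch (Δ - 1 + n) n = P4
  generalize eP5 : poch ((Δ + 1) / 2) n = P5
  have hP3 : P3 ≠ 0 := by rw [← eP3]; exact poch_ne_zero (by linarith) n
  have hP4 : P4 ≠ 0 := by rw [← eP4]; exact poch_ne_zero (by linarith) n
  have hP5 : P5 ≠ 0 := by rw [← eP5]; exact poch_ne_zero (by linarith) n
  generalize et1 : Δ - 1 / 2 + (n : ℝ) = t1
  generalize et2 : (Δ + 1) / 2 + (n : ℝ) = t2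
  generalize et3 : Δ - 1 + (n : ℝ) = t3
  generalize et4 : Δ + 2 * (n : ℝ) - 1 = t4
  generalize et7 : Δ + 2 * (n : ℝ) + 1 = t7
  generalize et5 : Δ + 2 * (n : ℝ) = t5
  generalize et6 : 2 * Δ + 2 * (n : ℝ) - 1 = t6
  have f1 : t1 ≠ 0 := by rw [← et1]; intro h; linarith
  have f2 : t2 ≠ 0 := by rw [← et2]; intro h; linarith
  have f3 : t3 ≠ 0 := by rw [← et3]; intro h; linarith
  have f4 : t4 ≠ 0 := by rw [← et4]; intro h; linarith
  have f5 : t5 ≠ 0 := by rw [← et5]; intro h; linarith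
  have f6 : t6 ≠ 0 := by rw [← et6]; intro h; linarith
  have f7' : t7 ≠ 0 := by rw [← et7]; intro h; linarith
  have f0 : (n.factorial : ℝ) ≠ 0 := by positivity
  have f7 : (4 : ℝ) ^ n ≠ 0 := by positivity
  field_simp
  subst et1 et2 et3 et4 et5 et6 et7
  ring

variable {Δ : ℝ}

/-- `α = Δ/2` at `ℓ = 0`. [folklore] -/
theorem halfTwist_zero_spin (Δ : ℝ) : halfTwist Δ 0 = Δ / 2 := by
  simp [halfTwist]

/-- The scalar lattice is symmetric. [folklore] -/
theorem scalarSite_symm (a b : ℕ) : scalarSite Δ a b = scalarSite Δ b a := by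
  unfold scalarSite
  by_cases h : a = b
  · subst h; rfl
  · rw [if_neg h, if_neg (Ne.symm h)]

/-- The scalar lattice vanishes on the row `b = 0` away from the corner `(0,0)`. [folklore] -/
theorem scalarSite_row_zero (a : ℕ) (ha : a ≠ 0) : scalarSite Δ a 0 = 0 := by
  simp [scalarSite, ha]

/-- `c_{00} = 1`. [folklore] -/
theorem scalarSite_corner : scalarSite Δ 0 0 = 1 := by
  simp [scalarSite]

/-- The diagonal step of the odd-site relation, `n ≥ 1`:
`c_{n+1}(μ_{n+1,n+1} - h_{n+1}) = c_n (μ_{nn} + h_n - 1) γ_{h_n}`. [folklore] -/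
theorem scalarSite_step (hΔ : 1 / 2 < Δ) {n : ℕ} (hn : 1 ≤ n) :
    scalarRedCoeff Δ (n + 1) * (siteMu Δ 0 (n + 1) (n + 1) - siteWeight Δ 0 (n + 1)) =
      scalarRedCoeff Δ n * (siteMu Δ 0 n n + siteWeight Δ 0 n - 1) * sl2Gamma (siteWeight Δ 0 n) := by
  have h := scalarRedCoeff_succ hΔ hn
  have hn1 : (1 : ℝ) ≤ n := by exact_mod_cast hn
  unfold siteMu siteWeight sl2Gamma casimirEigenvalue3D
  rw [halfTwist_zero_spin]
  push_cast
  have e1 : 2 * (Δ / 2 + ↑n) - 1 = Δ + 2 * n - 1 := by ring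
  have e2 : 2 * (Δ / 2 + ↑n) + 1 = Δ + 2 * n + 1 := by ring
  rw [e1, e2]
  have hW : (4 * (Δ + 2 * (n : ℝ) - 1) * (Δ + 2 * n + 1)) ≠ 0 := by
    have : 0 < Δ + 2 * (n : ℝ) - 1 := by linarith
    positivity
  rw [mul_div_assoc', eq_div_iff hW]
  linear_combination h

/-- The corner step of the odd-site relation: `c_1 (μ_{11} - h_1) = γ'_{h_0}`. [folklore] -/
theorem scalarSite_step_zero (hΔ : 1 / 2 < Δ) :
    scalarRedCoeff Δ 1 * (siteMu Δ 0 1 1 - siteWeight Δ 0 1) = sl2Gamma' (halfTwist Δ 0) := by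
  rw [scalarRedCoeff_one hΔ]
  unfold siteMu siteWeight sl2Gamma' casimirEigenvalue3D
  rw [halfTwist_zero_spin]
  push_cast
  have f1 : 2 * Δ - 1 ≠ 0 := by intro h; linarith
  have f2 : Δ + 1 ≠ 0 := by intro h; linarith
  have e2 : 2 * (Δ / 2) + 1 = Δ + 1 := by ring
  rw [e2]
  generalize et : 2 * Δ - 1 = t at f1 ⊢
  field_simp
  subst et
  ring

/-- **The odd-site relation for the scalar lattice.** [folklore] -/
theorem scalarSite_U_symm (hΔ : 1 / 2 < Δ) (a b : ℕ) :
    siteU Δ 0 (scalarSite Δ) a b = siteU Δ 0 (scalarSite Δ) b a := by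
  -- reduce to `a < b` by symmetry of the statement
  wlog hab : a < b generalizing a b
  · rcases Nat.lt_or_ge b a with h | h
    · exact (this b a h).symm
    · have : a = b := by omega
      subst this; rfl
  obtain ⟨d, rfl⟩ : ∃ d, b = a + d + 1 := ⟨b - a - 1, by omega⟩
  rcases Nat.eq_zero_or_pos d with rfl | hd
  · -- `b = a + 1`: the genuine recurrence
    simp only [add_zero]
    unfold siteU
    rw [show scalarSite Δ a (a + 1 + 1) = 0 by rw [scalarSite, if_neg (by omega)],
      show scalarSite Δ a (a + 1) = 0 by rw [scalarSite, if_neg (by omega)],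
      show scalarSite Δ (a + 1) (a + 1) = scalarRedCoeff Δ (a + 1) by rw [scalarSite, if_pos rfl],
      show scalarSite Δ (a + 1) a = 0 by rw [scalarSite, if_neg (by omega)]]
    rcases Nat.eq_zero_or_pos a with rfl | ha
    · -- corner: `W_{0,1} = c_{00} γ'`, `W_{1,0} = 0`
      rw [zero_add, siteW_one, siteW_zero, scalarSite_corner, scalarSite_step_zero hΔ]
      ring
    · obtain ⟨a', rfl⟩ : ∃ a', a = a' + 1 := ⟨a - 1, by omega⟩
      rw [show a' + 1 + 1 = a' + 2 from rfl, siteW_add_two,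
        show scalarSite Δ (a' + 1) (a' + 1) = scalarRedCoeff Δ (a' + 1) by rw [scalarSite, if_pos rfl]]
      -- `W_{a+1, a}`: `a = a'+1`; `siteW c (a'+2) (a'+1)`: cases `a' = 0` (→ `siteW _ 1 = c (a'+2) 0 γ' = 0`) or `a'+1 = a''+2`
      have hW : siteW Δ 0 (scalarSite Δ) (a' + 2) (a' + 1) = 0 := by
        rcases Nat.eq_zero_or_pos a' with rfl | ha'
        · rw [zero_add, siteW_one, scalarSite_row_zero 2 (by norm_num), zero_mul]
        · obtain ⟨a'', rfl⟩ : ∃ a'', a' = a'' + 1 := ⟨a' - 1, by omega⟩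
          rw [show a'' + 1 + 1 = a'' + 2 from rfl, siteW_add_two,
            show scalarSite Δ (a'' + 1 + 2) (a'' + 1) = 0 by rw [scalarSite, if_neg (by omega)]]
          ring
      rw [hW, show a' + 2 = a' + 1 + 1 from rfl, scalarSite_step hΔ (by omega)]
      ring
  · -- `b ≥ a + 2`: everything vanishes
    unfold siteU
    rw [show scalarSite Δ a (a + d + 1 + 1) = 0 by rw [scalarSite, if_neg (by omega)],
      show scalarSite Δ a (a + d + 1) = 0 by rw [scalarSite, if_neg (by omega)],
      show scalarSite Δ (a + d + 1) (a + 1) = 0 by rw [scalarSite, if_neg (by omega)],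
      show scalarSite Δ (a + d + 1) a = 0 by rw [scalarSite, if_neg (by omega)]]
    have hW1 : siteW Δ 0 (scalarSite Δ) a (a + d + 1) = 0 := by
      obtain ⟨e, he⟩ : ∃ e, a + d + 1 = e + 2 ∨ (a + d + 1 = 1) := ⟨a + d - 1, by omega⟩
      rcases he with he | he
      · rw [he, siteW_add_two, show scalarSite Δ a (e + 1) = 0 by rw [scalarSite, if_neg (by omega)]]; ring
      · rw [he, siteW_one, show scalarSite Δ a 0 = 0 by rw [scalarSite, if_neg (by omega)], zero_mul]
    have hW2 : siteW Δ 0 (scalarSite Δ) (a + d + 1) a = 0 := by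
      rcases a with _ | _ | a
      · rfl
      · rw [siteW_one, scalarSite_row_zero _ (by omega), zero_mul]
      · rw [siteW_add_two, show scalarSite Δ (a + 1 + 1 + d + 1) (a + 1) = 0 by rw [scalarSite, if_neg (by omega)]]; ring
    rw [hW1, hW2]
    ring

/-- **Dimensional reduction, scalar case, coefficient level.** For `Δ > 1/2` the array of the diagonal
sum `Σ_n 𝒜_{n,0}(Δ,0) k_{Δ+2n}(z) k_{Δ+2n}(z̄)` satisfies the three-dimensional coefficient Casimir system of
the scalar block of dimension `Δ` (external `Δ₁₂ = Δ₃₄ = 0`), is symmetric, and has the Dolan–Osborn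
leading part. [cite: Hogervorst2016, §2 eqs. (2.24), (2.35)] -/
theorem scalar_redArr_satisfies (hΔ : 1 / 2 < Δ) :
    SatisfiesCoeffCasimir 0 0 Δ 0 (redArr Δ 0 (scalarSite Δ)) ∧
      (∀ p : ℕ × ℕ, redArr Δ 0 (scalarSite Δ) (p.2, p.1) = redArr Δ 0 (scalarSite Δ) p) ∧
      HasLeadingPart 0 (redArr Δ 0 (scalarSite Δ)) := by
  have hα : 0 < halfTwist Δ 0 := by rw [halfTwist_zero_spin]; linarith
  refine ⟨redArr_satisfiesCoeffCasimir hα _ (scalarSite_symm) (fun a ha => scalarSite_row_zero a ha)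
      (scalarSite_U_symm hΔ), redArr_symm _ scalarSite_symm, ?_⟩
  exact redArr_hasLeadingPart _ (fun a ha => scalarSite_row_zero a ha) scalarSite_corner

/-- `ℓ = 0` has no accidental degeneracy above the unitarity bound `Δ > 1/2`. [folklore] -/
theorem not_accidentalDegeneracy3D_scalar (hΔ : 1 / 2 < Δ) : ¬ accidentalDegeneracy3D Δ 0 := by
  rintro ⟨n, j, hn, hj, hpar, h⟩
  push_cast at h
  have hn1 : (1 : ℝ) ≤ n := by exact_mod_cast hn
  have hj0 : (0 : ℝ) ≤ j := by exact_mod_cast Nat.zero_le j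
  -- `2nΔ + n(n-3) + j(j+1) = 0` with `Δ > 1/2`, `n ≥ 1`: `2nΔ > n`, so `n(n-2) + j(j+1) < 0`, forcing `n = 1`,
  -- then `2Δ - 2 + j(j+1) = 0` with `j ≤ 1`, `j ≡ 1 (mod 2)`: `j = 1`, `Δ = 0` — contradiction.
  have hn' : n ≤ 1 := by
    by_contra hc
    have : (2 : ℝ) ≤ n := by exact_mod_cast (by omega : 2 ≤ n)
    nlinarith
  have hn1' : n = 1 := by omega
  subst hn1'
  have hj1 : j = 1 := by
    interval_cases j
    · simp at hpar
    · rfl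
  subst hj1
  push_cast at h
  linarith

/-- **Hogervorst's dimensional reduction for scalar blocks at `d = 3`, coefficient level.**
For `Δ > 1/2`, the monomial array of the `d = 3` scalar block `g_{Δ,0}` (Dolan–Osborn normalisation,
`hrMonomialCoeff Δ 0`) IS the array of `Σ_{n ≥ 0} 𝒜_{n,0}(Δ,0) k_{Δ+2n}(z) k_{Δ+2n}(z̄)`:
`k^{HR}_{PQ} = Σ_n 𝒜_{n,0}(Δ,0) κ_{Δ/2+n}(P-n) κ_{Δ/2+n}(Q-n)` for all `(P,Q)`. This is eq. (2.35) ("master";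
the expansion itself is eq. (2.24)) of Hogervorst 2016 at `d = 3`, `ℓ = 0` — there a conjecture checked to finite order; Pal–Qiao–Rychkov 2023
Thm A.5 ("the complete proof … is so far missing"); derived for `d = 3` via fractional calculus by Song 2025 (§3,
scalar case `A_{n,0}`). The proof here is independent and elementary. [cite: Hogervorst2016, §2 eqs. (2.24), (2.35)]
[cite: PalQiaoRychkov2023, App. A.2 Thm A.5] [cite: Song2025, §1, §3] -/
theorem hrMonomialCoeff_eq_scalar_redArr (hΔ : 1 / 2 < Δ) :
    hrMonomialCoeff Δ 0 = redArr Δ 0 (scalarSite Δ) := by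
  obtain ⟨h1, h2, h3⟩ := scalar_redArr_satisfies hΔ
  have hb : unitarityBound3D 0 < Δ := by simpa [unitarityBound3D] using hΔ
  exact (h1.eq_hrMonomialCoeff hb (not_accidentalDegeneracy3D_scalar hΔ) h2 h3).symm

/-- The same, entrywise and unfolded: `k^{HR}_{PQ}(Δ, ℓ=0) = Σ_{n ≤ min(P,Q)} 𝒜_{n,0} κ_{Δ/2+n}(P-n) κ_{Δ/2+n}(Q-n)`.
[cite: Hogervorst2016, §2 eqs. (2.24), (2.35)] -/
theorem hrMonomialCoeff_scalar_apply (hΔ : 1 / 2 < Δ) (P Q : ℕ) :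
    hrMonomialCoeff Δ 0 (P, Q) =
      ∑ n ∈ range (P + 1), scalarRedCoeff Δ n *
        (sl2CoeffZ (Δ / 2 + n) ((P : ℤ) - n) * sl2CoeffZ (Δ / 2 + n) ((Q : ℤ) - n)) := by
  rw [hrMonomialCoeff_eq_scalar_redArr hΔ]
  unfold redArr
  refine Finset.sum_congr rfl fun a _ => ?_
  have inner : ∑ b ∈ range (Q + 1), scalarSite Δ a b * siteK Δ 0 a P * siteK Δ 0 b Q =
      scalarRedCoeff Δ a * (siteK Δ 0 a P * siteK Δ 0 a Q) := by
    unfold scalarSite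
    simp_rw [ite_mul, zero_mul]
    rw [Finset.sum_ite_eq]
    split_ifs with h
    · ring
    · rw [mem_range, not_lt] at h
      rw [siteK_eq_zero_of_lt (Δ := Δ) (ℓ := 0) a (m := (Q : ℤ)) (by omega)]
      ring
  simp only at inner ⊢
  rw [inner]
  unfold siteK
  rw [halfTwist_zero_spin]

end Scalar

end Literature.MathematicalPhysics.QuantumFieldTheory.ConformalBootstrap3D
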